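import Mathlib
import Summits.ResolutionOfSingularities.ResolutionOfSingularities.Theorems.WeightedInvariantLocalWeightedDropWildMonicSCleanTransport
import Summits.ResolutionOfSingularities.ResolutionOfSingularities.Theorems.WeightedInvariantLocalWeightedDropWildMonicFlagDropTangentStep

/-!
# `WeightedInvariant.LocalWeightedDrop`, line `hasse-ridge-face-selection`, S3ρ flag line: (C4e′) SECONDARY `ord`-CLEANNESS IS PRESERVED
# BY THE AXIS SUCCESSOR IN NORMAL FORM when `d′ = d` (Perlega Prop. 6.1.3 (2) for `x^{d−j}·T_j = A_j(x, xy)`)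

Crux item stmt-ResolutionOfSingularities-8899 `LocalWeightedDrop` (route `ResolutionOfSingularities/WeightedInvariant`), engine of the
door `HypersurfaceCentreConstruction` stmt-ResolutionOfSingularities-19897.  [OURS · L1 W4.3, chain w43, res-D-pv-056 AS res-L1-w43-stub-5:
the (C4e) theorem `isSClean_pointStep₀_iff` (…WildMonicSCleanTransport, stated for the lift data `(c, Bv, hB)` of stub-7's §PointStep)
RESTATED FOR res-type-083's SUCCESSOR NORMAL FORM `x^{d−j}·T_j = A_j(x, xy)` (`IsAxisStep` / `DropAxisShape`, `PlaneGerm.dirChart 0`), i.e.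
the form in which the (D1) hand (`DropAxisN0First`, Per17 9.1.4 case (1): «By Proposition (s_clean_stable_under_blowup) the element `f′` is
secondary ord-clean …») consumes it.  MAP: S. Perlega, arXiv:2011.14443 Ch. 6 §1.1 Prop. 6.1.3 (2).  Every object is OURS; nothing here is
a statement of H. Hironaka's manuscript [claim: Hironaka2017, status: under-review].]

* `redPt_axisSucc` — the reduced scaled point of the successor exponent `Ψ_{d−i} e` is `Ψ_δ` of that of `e`;
* `rowMin_axisSucc_iff` — least row exponents shift by `j − (d−i)`;
* `isSClean_axisSucc_iff` — `IsSClean p (excNext E) T ↔ IsSClean p E A` when `dRes` is kept (the point-set lemmas `onSLine_psi_iff`,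
  `aboveSLine_psi_iff`, `psi_sub_excExp_excNext` are those of …WildMonicSCleanTransport; the support transport is …FlagDropTangentStep's
  `coeff_axisSucc_ne_zero_iff` / `newtonSet_axisSucc`).
-/

set_option linter.dupNamespace false -- mandated namespace of this single-conjunct summit

noncomputable section

namespace Summit.ResolutionOfSingularities.ResolutionOfSingularities.Theorems

namespace WildMonic

open MvPowerSeries MonicDescent Literature.AlgebraicGeometry.Resolution

variable {k : Type} [Field k]

/-! ## The axis successor in normal form, slot by slot: reduced points and least row exponents -/

section AxisSucc

variable {d : ℕ} (A T : Fin d → MvPowerSeries (Fin 2) k)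
  (hT : ∀ j : Fin d, (X 0 : MvPowerSeries (Fin 2) k) ^ (d - (j : ℕ)) * T j = subst (PlaneGerm.dirChart (0 : k)) (A j))

include hT in
/-- THE REDUCED SCALED POINT OF A SUCCESSOR EXPONENT: for a support exponent `e` of the sheared slot `i`, the successor exponent `Ψ_{d−i} e`
has reduced scaled point `Ψ_δ` of that of `e` (`δ = dRes E (newtonSet (A∘σ))`, successor boundary `excNext E`).
[cite: Perlega2020, Prop. 6.1.3 proof (arXiv:2011.14443 Ch. 6 §1.1, p0069 L62–L66)] -/
theorem redPt_axisSucc (E : Finset (Fin 2)) (hσ : ∀ j : Fin d, ((d - (j : ℕ) : ℕ) : ℕ∞) ≤ (A j).order)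
    (i : Fin d) {e : Fin 2 →₀ ℕ} (he : coeff e (A i) ≠ 0) :
    redPt T (excNext E) i (psi (d - (i : ℕ)) e) =
      psi (dRes E (newtonSet (A))) (redPt (A) E i e) := by
  have hN : (newtonSet (A)).Nonempty := ⟨_, smul_mem_newtonSet (A) i he⟩
  have hL : ∀ P ∈ newtonSet (A), d.factorial ≤ P 0 + P 1 := fun P hP => factorial_le_of_mem_newtonSet hσ hP
  unfold redPt
  rw [newtonSet_axisSucc A T hT hσ, smul_psi, slotWeight_mul_sub i]
  exact psi_sub_excExp_excNext E hN hL (smul_mem_newtonSet (A) i he)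

/-- The reduced scaled point of a support exponent has total degree `≥ δ`. -/
theorem dRes_le_redPt_add' (E : Finset (Fin 2)) (i : Fin d) {e : Fin 2 →₀ ℕ} (he : coeff e (A i) ≠ 0) :
    dRes E (newtonSet (A)) ≤ redPt (A) E i e 0 + redPt (A) E i e 1 :=
  dRes_le_of_mem_reduce (redPt_mem_reduce (A) E i he)

include hT in
/-- THE LEAST `x₁`-EXPONENT OF A ROW under the point step: the row `j` of the successor slot `i` has least `x₁`-exponent `a + j − (d−i)`
iff the row `j` of the sheared source slot has least `x₁`-exponent `a` (for `a + j ≥ d − i`; «`f′_{c−q,ĵq} = x^{(ĵ−1)q} f_{c−q,ĵq}`»).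
[cite: Perlega2020, Prop. 6.1.3 (2) proof (arXiv:2011.14443 Ch. 6 §1.1, p0069 L95–L105)] -/
theorem rowMin_axisSucc_iff (hσ : ∀ j : Fin d, ((d - (j : ℕ) : ℕ) : ℕ∞) ≤ (A j).order) (i : Fin d) (j a : ℕ)
    (hq : d - (i : ℕ) ≤ a + j) :
    RowMin (T i) j (a + j - (d - (i : ℕ))) ↔ RowMin (A i) j a := by
  have hiff := coeff_axisSucc_ne_zero_iff A T hT i
  constructor
  · rintro ⟨hne, hmin⟩
    rw [hiff, pt_apply_zero, pt_apply_one] at hne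
    obtain ⟨-, hne⟩ := hne
    have ha : a + j - (d - (i : ℕ)) + (d - (i : ℕ)) - j = a := by omega
    rw [ha] at hne
    refine ⟨hne, fun a' ha' => ?_⟩
    by_contra hne'
    have hq' : d - (i : ℕ) ≤ a' + j := by
      have h := sub_le_add_of_coeff_ne_zero A (hσ i) hne'
      rwa [pt_apply_zero, pt_apply_one] at h
    have h2 := hmin (a' + j - (d - (i : ℕ))) (by omega)
    rw [← not_ne_iff, hiff, pt_apply_zero, pt_apply_one] at h2
    exact h2 ⟨by omega, by rwa [show a' + j - (d - (i : ℕ)) + (d - (i : ℕ)) - j = a' by omega]⟩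
  · rintro ⟨hne, hmin⟩
    refine ⟨?_, fun a' ha' => ?_⟩
    · rw [hiff, pt_apply_zero, pt_apply_one]
      exact ⟨by omega, by rwa [show a + j - (d - (i : ℕ)) + (d - (i : ℕ)) - j = a by omega]⟩
    · by_contra hne'
      rw [← ne_eq, hiff, pt_apply_zero, pt_apply_one] at hne'
      obtain ⟨hle, hne'⟩ := hne'
      exact hne' (hmin _ (by omega))

/-! ## Perlega Prop. 6.1.3 (2) in the game -/

include hT in
/-- **PERLEGA PROP. 6.1.3 (2) IN THE GAME — SECONDARY `ord`-CLEANNESS IS PRESERVED BY THE MONOMIAL POINT STEP WHEN `d′ = d`**, here an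
EQUIVALENCE: for the point-step successor `Tt` (slot `0`, exceptional point `c`, `c₁ ≠ 0`) of a position whose sheared coefficients have
`ord (A∘σ)_j ≥ d − j`, if the residual order is kept (`dRes (excNext E) (newtonSet Tt) = dRes E (newtonSet (A∘σ))`), then `Tt` is
secondary `ord`-clean for the successor boundary `excNext E` iff `A∘σ` is secondary `ord`-clean for `E`.  Termwise: supports correspond by
`Ψ_{d−i}`, reduced scaled points by `Ψ_δ` (`redPt_pointStep₀`), the `s`-line by `s′ + δ! = s` (`sFlag_excNext_image_psi`,
`onSLine_psi_iff`, `aboveSLine_psi_iff`), the second exceptional exponent is unchanged (`excExp_excNext_image_psi`), and least row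
exponents shift by `j − q ∈ qℤ` in the slot `d − q` (`rowMin_pointStep₀_iff`).
[cite: Perlega2020, Prop. 6.1.3 (2) `s_clean_stable_under_blowup` (arXiv:2011.14443 Ch. 6 §1.1, p0069 L60 – p0070 L2)] -/
theorem isSClean_axisSucc_iff (p : ℕ) (E : Finset (Fin 2))
    (hσ : ∀ j : Fin d, ((d - (j : ℕ) : ℕ) : ℕ∞) ≤ (A j).order) (hN : (newtonSet (A)).Nonempty)
    (hkeep : dRes (excNext E) (newtonSet T) = dRes E (newtonSet (A))) :
    IsSClean p (excNext E) T ↔ IsSClean p E (A) := by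
  set Tt : Fin d → MvPowerSeries (Fin 2) k := T with hTt
  set N := newtonSet (A) with hNdef
  set δ := dRes E N with hδ
  have hL : ∀ P ∈ N, d.factorial ≤ P 0 + P 1 := fun P hP => factorial_le_of_mem_newtonSet hσ hP
  have hN' : newtonSet Tt = psi d.factorial '' N := newtonSet_axisSucc A T hT hσ
  have hkeep' : dRes (excNext E) (psi d.factorial '' N) = δ := by rw [← hN']; exact hkeep
  have hr1 : excExp (excNext E) (newtonSet Tt) 1 = excExp E N 1 := by
    rw [hN']; exact (excExp_excNext_image_psi E d.factorial hN).2
  have hs : sFlag (excNext E) (newtonSet Tt) + (δ.factorial : ℕ∞) = sFlag E N := by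
    rw [hN']; exact sFlag_excNext_image_psi E hN hL hkeep'
  -- `d − (d − q) = q`
  have hdq : ∀ i : Fin d, (i : ℕ) = d - qOf p d → d - (i : ℕ) = qOf p d := fun i hi => by
    have := Nat.le_of_dvd (Fin.pos i) (qOf_dvd p d); omega
  unfold IsSClean
  refine forall_congr' fun b => ?_
  rw [hkeep, hr1]
  refine imp_congr_right fun _ => or_congr ?_ (or_congr ?_ ?_)
  · -- (i)_b
    constructor
    · rintro ⟨i, β, hi, hβ, hβ1, hon⟩
      obtain ⟨e, he, hq, rfl⟩ := exists_psi_of_coeff_axisSucc_ne_zero A T hT i hβ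
      rw [psi_apply_one] at hβ1
      refine ⟨i, e, hi, he, hβ1, ?_⟩
      rw [redPt_axisSucc A T hT E hσ i he] at hon
      exact (onSLine_psi_iff hs (dRes_le_redPt_add' A E i he)).mp hon
    · rintro ⟨i, e, hi, he, he1, hon⟩
      refine ⟨i, psi (d - (i : ℕ)) e, hi,
        coeff_psi_axisSucc_ne_zero A T hT i he (sub_le_add_of_coeff_ne_zero A (hσ i) he), ?_, ?_⟩
      · rw [psi_apply_one]; exact he1
      · rw [redPt_axisSucc A T hT E hσ i he]
        exact (onSLine_psi_iff hs (dRes_le_redPt_add' A E i he)).mpr hon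
  · -- (ii)_b
    constructor
    · intro h i e hi he he1
      have hβ := coeff_psi_axisSucc_ne_zero A T hT i he (sub_le_add_of_coeff_ne_zero A (hσ i) he)
      have h2 := h i (psi (d - (i : ℕ)) e) hi hβ (by rw [psi_apply_one]; exact he1)
      rw [redPt_axisSucc A T hT E hσ i he] at h2
      exact (aboveSLine_psi_iff hs (dRes_le_redPt_add' A E i he)).mp h2
    · intro h i β hi hβ hβ1
      obtain ⟨e, he, hq, rfl⟩ := exists_psi_of_coeff_axisSucc_ne_zero A T hT i hβ
      rw [psi_apply_one] at hβ1
      rw [redPt_axisSucc A T hT E hσ i he]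
      exact (aboveSLine_psi_iff hs (dRes_le_redPt_add' A E i he)).mpr (h i e hi he hβ1)
  · -- (iii)_b
    constructor
    · rintro ⟨i, a', hi, hrow, hndvd⟩
      have hq := hdq i hi
      -- the least successor exponent comes from a source exponent
      have hne := hrow.1
      rw [coeff_axisSucc_ne_zero_iff A T hT i, pt_apply_zero, pt_apply_one] at hne
      obtain ⟨hle, -⟩ := hne
      refine ⟨i, a' + (d - (i : ℕ)) - b * qOf p d, hi, ?_, ?_⟩
      · rw [← rowMin_axisSucc_iff A T hT hσ i (b * qOf p d) _ (by omega)]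
        rwa [show a' + (d - (i : ℕ)) - b * qOf p d + b * qOf p d - (d - (i : ℕ)) = a' by omega]
      · rw [hq] at hle ⊢
        intro hdvd
        apply hndvd
        have h1 : qOf p d ∣ a' + qOf p d - b * qOf p d + b * qOf p d := Nat.dvd_add hdvd (dvd_mul_left _ _)
        rw [show a' + qOf p d - b * qOf p d + b * qOf p d = a' + qOf p d by omega] at h1
        exact (Nat.dvd_add_left (dvd_refl _)).mp h1
    · rintro ⟨i, a, hi, hrow, hndvd⟩
      have hq := hdq i hi
      have hle : d - (i : ℕ) ≤ a + b * qOf p d := by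
        have h := sub_le_add_of_coeff_ne_zero A (hσ i) hrow.1
        rwa [pt_apply_zero, pt_apply_one] at h
      refine ⟨i, a + b * qOf p d - (d - (i : ℕ)), hi, (rowMin_axisSucc_iff A T hT hσ i _ a hle).mpr hrow, ?_⟩
      rw [hq] at hle ⊢
      intro hdvd
      apply hndvd
      have h1 : qOf p d ∣ a + b * qOf p d - qOf p d + qOf p d := Nat.dvd_add hdvd (dvd_refl _)
      rw [show a + b * qOf p d - qOf p d + qOf p d = a + b * qOf p d by omega] at h1
      exact (Nat.dvd_add_left (dvd_mul_left _ _)).mp h1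

end AxisSucc

end WildMonic

end Summit.ResolutionOfSingularities.ResolutionOfSingularities.Theorems

end
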